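import Summits.ValiantsHypothesis.ValiantsHypothesis.Theorems.GrenetZeonDualUnipotentThreeHalvesLongMassMonomialWalk
import Summits.ValiantsHypothesis.ValiantsHypothesis.Theorems.GrenetZeonDualUnipotentThreeHalvesLongMassLedgerTorusSlow
import Summits.ValiantsHypothesis.ValiantsHypothesis.Theorems.GrenetZeonDualUnipotentThreeHalvesLongMassIrreducibilityFree

/-!
# `GrenetZeon.DualUnipotentThreeHalves` (stmt-ValiantsHypothesis-24318), line `slow_core`, stub (c) `SlowCore.LongMassSlowLawInv`:
# SEPARATED PRODUCTS — a mixed-word LOWER-bound instrument for certificates of the free triangular pencil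

The research stub (c) (`LongMassSlowLawInv` ⟺ `LongMassSlowLawAll`, ✓ `inv_iff_all`) prices nilpotent affine pencils by whole-pencil
certificates `(K, k)` (`SlowCore.Ledger`: along `v ∈ K` every power `p ≤ n − 1` of `N(x + s v)` has `s`-degree `≤ k`) of price `n·k + codim K`.
The lower-side instruments of record are the INDEX SHADOW (✓ `LedgerIndex.linMat_pow_eq_zero_of_ledger`: `(lin v)^{k+1} = 0`), the torus count
(✓ `LedgerTorus.not_relCert_of_count`, which for the free triangular pencil is EMPTY beyond order `0`: every coordinate direction `E_{ij}` is in the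
window cone of order `1`) and monomial walks (✓ `…MonomialWalk`).  None of them sees the model enemy `𝔫_b` at the conjectured rate.

This file supplies the first instrument that does — it uses the POINT VALUES against the directions (deep / mixed-word mode):

* `coeff_succ_mulVec_apply`, `coeff_zero_mulVec_apply` — `[s^d]`-bookkeeping of `(A + sW)·u` over `ℂ[s]`.
* ★ `coeff_pow_apply_of_separated` — **THE COEFFICIENT IDENTITY.**  For positions `r 0 < r' 0 < r 1 < r' 1 < ⋯ < r k < r' k`, `W` strictly
  upper triangular and `A = Σ_{l<k} E_{r' l, r (l+1)}` the CONNECTOR matrix: `[s^{k+1}] ((A + sW)^{2k+1})_{r 0, r' k} = ∏_{l ≤ k} W_{r l, r' l}`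
  (the only word of `s`-degree `k+1` from `r 0` to `r' k` in `2k+1` letters is `W A W A ⋯ A W`; kernel proof by a coefficient-array
  invariant on `(A + sW)^{2j} e_{r' k}`, no path sums).
* `isAffine_free`, `pow_eq_zero_free`, `pointMat_free`, `linMat_free` — the FREE TRIANGULAR PENCIL `N_{ij} = x_{(ι i, ι j)}` (`i < j`, `ι : Fin b ↪ Fin n`)
  is an affine nilpotent pencil (`N ^ b = 0`) whose values / linear parts are ALL strictly upper triangular matrices.
* ★ `prod_eq_zero_of_ledger` — **SEPARATED-PRODUCT TEST**: if `(K, k)` is a whole-pencil ledger of the free triangular pencil and `2k + 2 ≤ n`, then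
  for every separated `(k+1)`-tuple of positions and every `v ∈ K`:  `∏_l v (ι (r l), ι (r' l)) = 0` (test point = the connector).
* ★ `exists_dead_of_ledger` — hence ONE coordinate of every separated tuple is DEAD on `K` (`v ↦ v c` vanishes on `K`; Mathlib
  `Module.Dual.exists_forall_mem_ne_zero_of_forall_exists`: a subspace is not a finite union of proper subspaces).

The count (at most `k·(d+1)` live positions per diagonal `d`, `codim K ≥ Σ_d (b − d − k(d+1))`, price `(P + n + 2b)² ≥ 2·n·b²`, and «(c) fails at
`c = 1`») is in the sequel ✓ `…LongMassFreeTriangularPrice`.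

HONEST FRAMING.  Instrument / calibration (`--supports stmt-ValiantsHypothesis-24318`): a LOWER bound for ONE (reducible, triangular) pencil family;
it bears on the RATE and CONSTANT of (c), NOT on its truth for some `c`; (c) `LongMassSlowLawInv` is RESEARCH — OPEN; closes no stub; S3, 24318,
8062 (`stub_dualUnipotent`) and `VP ≠ VNP` are NOT proved.  Def-free, no named facts, no sorry.  [folklore: weighted paths in a DAG; interval
piercing replaced by an arithmetic-progression pigeonhole]
-/

set_option linter.dupNamespace false
set_option autoImplicit false

noncomputable section

namespace Summit.ValiantsHypothesis.ValiantsHypothesis.Theorems.GrenetZeon.FreeTriangularPrice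

open MvPolynomial Matrix
open scoped BigOperators
open Summit.ValiantsHypothesis.ValiantsHypothesis.Cruxes.TwoDimCoefficients.DimTwoCases (AffMat IsAffine)
open Summit.ValiantsHypothesis.ValiantsHypothesis.Theorems.GrenetZeon.RadicalSplit (lineSubst)
open Summit.ValiantsHypothesis.ValiantsHypothesis.Theorems.GrenetZeon.SlowCore (linEntry Ledger RelCert)
open Summit.ValiantsHypothesis.ValiantsHypothesis.Theorems.GrenetZeon.ResolventFlag (pointMat linMat)
open Summit.ValiantsHypothesis.ValiantsHypothesis.Theorems.GrenetZeon.MonomialWalk (map_lineSubst_eq_pointMat)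
open Summit.ValiantsHypothesis.ValiantsHypothesis.Theorems.GrenetZeon.InitialForm.SlowCurve (totalDegree_le_iff_coeff)
open Summit.ValiantsHypothesis.ValiantsHypothesis.Theorems.GrenetZeon.InitialForm.SlowTorus (finrank_span_single)

/-! ## §1 Coefficient bookkeeping for the line matrix `A + s·W` -/

section LineMatrix
variable {m : ℕ}

/-- `[s^{d+1}]` of an entry of `(A + s W)·u`: the `A`-part keeps the degree, the `W`-part raises it by one. [folklore] -/
theorem coeff_succ_mulVec_apply (A W : Matrix (Fin m) (Fin m) ℂ) (u : Fin m → MvPolynomial (Fin 1) ℂ) (α : Fin m) (d : ℕ) :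
    coeff (Finsupp.single 0 (d + 1))
        (((A.map (C : ℂ →+* MvPolynomial (Fin 1) ℂ) + (X 0 : MvPolynomial (Fin 1) ℂ) • W.map (C : ℂ →+* MvPolynomial (Fin 1) ℂ))
          *ᵥ u) α) =
      ∑ β, (A α β * coeff (Finsupp.single 0 (d + 1)) (u β) + W α β * coeff (Finsupp.single 0 d) (u β)) := by
  classical
  simp only [Matrix.mulVec, dotProduct, Matrix.add_apply, Matrix.smul_apply, Matrix.map_apply,
    smul_eq_mul, coeff_sum, add_mul, coeff_add, coeff_C_mul]
  refine Finset.sum_congr rfl fun β _ => ?_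
  congr 1
  rw [mul_assoc, coeff_X_mul', if_pos (by simp), coeff_C_mul]
  congr 2
  rw [← Finsupp.single_tsub, Nat.add_sub_cancel]

/-- `[s^0]` of an entry of `(A + s W)·u`: only the `A`-part. [folklore] -/
theorem coeff_zero_mulVec_apply (A W : Matrix (Fin m) (Fin m) ℂ) (u : Fin m → MvPolynomial (Fin 1) ℂ) (α : Fin m) :
    coeff (Finsupp.single 0 0)
        (((A.map (C : ℂ →+* MvPolynomial (Fin 1) ℂ) + (X 0 : MvPolynomial (Fin 1) ℂ) • W.map (C : ℂ →+* MvPolynomial (Fin 1) ℂ))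
          *ᵥ u) α) =
      ∑ β, A α β * coeff (Finsupp.single 0 0) (u β) := by
  classical
  simp only [Matrix.mulVec, dotProduct, Matrix.add_apply, Matrix.smul_apply, Matrix.map_apply,
    smul_eq_mul, coeff_sum, add_mul, coeff_add, coeff_C_mul]
  refine Finset.sum_congr rfl fun β _ => ?_
  rw [mul_assoc, coeff_X_mul', if_neg (by simp), add_zero]

/-- **SEPARATED PRODUCTS — the coefficient identity.**  Let `r 0 < r' 0 < r 1 < r' 1 < ⋯ < r k < r' k` be positions, `W` strictly upper
triangular, and `A` the CONNECTOR matrix (`A (r' l) (r (l+1)) = 1` for `l < k`, all other entries `0`).  Then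
`[s^{k+1}] ((A + sW)^{2k+1})_{r 0, r' k} = ∏_{l ≤ k} W (r l) (r' l)`: the only word of `s`-degree `k + 1` joining `r 0` to `r' k` in `2k+1`
letters is `W A W A ⋯ A W` along the positions. [folklore: unique weighted path] -/
theorem coeff_pow_apply_of_separated (A W : Matrix (Fin m) (Fin m) ℂ) (k : ℕ) (r r' : ℕ → Fin m)
    (hrr' : ∀ l, l ≤ k → r l < r' l) (hsep : ∀ l, l < k → r' l < r (l + 1))
    (hW : ∀ α β : Fin m, β ≤ α → W α β = 0)
    (hA1 : ∀ l, l < k → A (r' l) (r (l + 1)) = 1)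
    (hA0 : ∀ α β : Fin m, (∀ l, l < k → α = r' l → β ≠ r (l + 1)) → A α β = 0) :
    coeff (Finsupp.single 0 (k + 1))
      (((A.map (C : ℂ →+* MvPolynomial (Fin 1) ℂ) + (X 0 : MvPolynomial (Fin 1) ℂ) • W.map (C : ℂ →+* MvPolynomial (Fin 1) ℂ))
        ^ (2 * k + 1)) (r 0) (r' k)) = ∏ l ∈ Finset.range (k + 1), W (r l) (r' l) := by
  classical
  set M : Matrix (Fin m) (Fin m) (MvPolynomial (Fin 1) ℂ) :=
    A.map (C : ℂ →+* MvPolynomial (Fin 1) ℂ) + (X 0 : MvPolynomial (Fin 1) ℂ) • W.map (C : ℂ →+* MvPolynomial (Fin 1) ℂ) with hM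
  -- monotonicity of the interleaved positions
  have hmono : ∀ l l', l < l' → l' ≤ k → r' l < r l' := by
    intro l l' hll' hl'
    induction l' with
    | zero => exact absurd hll' (Nat.not_lt_zero _)
    | succ l' ih =>
      rcases Nat.lt_succ_iff_lt_or_eq.1 hll' with h | h
      · exact lt_trans (ih h (by omega)) (lt_trans (hrr' l' (by omega)) (hsep l' (by omega)))
      · subst h; exact hsep l (by omega)
  have hrr'2 : ∀ l l', l ≤ l' → l' ≤ k → r l < r' l' := by
    intro l l' hll' hl'
    rcases Nat.lt_or_eq_of_le hll' with h | h
    · exact lt_trans (hrr' l (by omega)) (lt_trans (hmono l l' h hl') (hrr' l' hl'))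
    · subst h; exact hrr' l hl'
  -- rows of `A` are the `r' l`, `l < k`; every other row vanishes
  have hrow : ∀ α : Fin m, (∀ l, l < k → α ≠ r' l) → ∀ β, A α β = 0 :=
    fun α hα β => hA0 α β fun l hl hαl => absurd hαl (hα l hl)
  have hrow_r : ∀ l, l ≤ k → ∀ β, A (r l) β = 0 := by
    intro l hl β
    refine hrow _ (fun l' hl' h => ?_) β
    rcases lt_or_ge l' l with h' | h'
    · exact absurd h (ne_of_gt (hmono l' l h' hl))
    · exact absurd h (ne_of_lt (hrr'2 l l' h' (by omega)))
  have hrowr' : ∀ l, l < k → ∀ β, β ≠ r (l + 1) → A (r' l) β = 0 := by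
    intro l hl β hβ
    refine hA0 _ _ fun l' hl' h => ?_
    have : l = l' := by
      by_contra hne
      rcases lt_or_gt_of_ne hne with h' | h'
      · exact absurd h (ne_of_lt (lt_trans (hmono l l' h' (by omega)) (hrr' l' (by omega))))
      · exact absurd h (ne_of_gt (lt_trans (hmono l' l h' (by omega)) (hrr' l (by omega))))
    subst this; exact hβ
  -- the vectors `u_j = M^{2j} e_{r' k}` and their coefficient arrays
  set e : Fin m → MvPolynomial (Fin 1) ℂ := Pi.single (r' k) 1 with he
  have INV : ∀ j, j ≤ k →
      (∀ α, ∀ d, d < j → coeff (Finsupp.single 0 d) (((M ^ (2 * j)) *ᵥ e) α) = 0) ∧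
      (∀ α, (∀ m', m' ≤ k - j → α ≠ r' m') → coeff (Finsupp.single 0 j) (((M ^ (2 * j)) *ᵥ e) α) = 0) ∧
      coeff (Finsupp.single 0 j) (((M ^ (2 * j)) *ᵥ e) (r' (k - j))) = ∏ l ∈ Finset.Ico (k - j + 1) (k + 1), W (r l) (r' l) := by
    intro j
    induction j with
    | zero =>
      intro _
      refine ⟨fun α d hd => absurd hd (Nat.not_lt_zero _), fun α hα => ?_, ?_⟩
      · rw [Nat.mul_zero, pow_zero, Matrix.one_mulVec, he, Pi.single_apply, if_neg (hα k (by omega)), MvPolynomial.coeff_zero]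
      · rw [Nat.mul_zero, pow_zero, Matrix.one_mulVec, he, Nat.sub_zero, Pi.single_eq_same, Finset.Ico_self,
          Finset.prod_empty, Finsupp.single_zero]
        exact MvPolynomial.coeff_zero_one
    | succ j ih =>
      intro hj
      obtain ⟨h1, h2, h3⟩ := ih (by omega)
      set u := (M ^ (2 * j)) *ᵥ e with hu
      set w := M *ᵥ u with hw
      have hu' : (M ^ (2 * (j + 1))) *ᵥ e = M *ᵥ w := by
        rw [hw, hu, Matrix.mulVec_mulVec, Matrix.mulVec_mulVec,
          show 2 * (j + 1) = 2 * j + 1 + 1 by ring, pow_succ', pow_succ', Matrix.mul_assoc]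
      -- `w ≡ 0 mod s^{j+1}`
      have hw0 : ∀ β, ∀ d, d ≤ j → coeff (Finsupp.single 0 d) (w β) = 0 := by
        intro β d hd
        rcases d with _ | d
        · rw [hw, hM, coeff_zero_mulVec_apply]
          refine Finset.sum_eq_zero fun γ _ => ?_
          rcases Nat.eq_zero_or_pos j with hj0 | hj0
          · -- `j = 0`: `u = e`, and the column `r' k` of `A` vanishes
            by_cases hγ : γ = r' k
            · subst hγ
              by_cases hβ : ∃ l, l < k ∧ β = r' l
              · obtain ⟨l, hl, rfl⟩ := hβ
                rw [hrowr' l hl _ (ne_of_gt (hrr'2 (l + 1) k (by omega) le_rfl)), zero_mul]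
              · push Not at hβ
                rw [hrow β (fun l hl h => hβ l hl h) _, zero_mul]
            · rw [hu, hj0, Nat.mul_zero, pow_zero, Matrix.one_mulVec, he, Pi.single_apply, if_neg hγ,
                MvPolynomial.coeff_zero, mul_zero]
          · rw [h1 γ 0 hj0, mul_zero]
        · rw [hw, hM, coeff_succ_mulVec_apply]
          refine Finset.sum_eq_zero fun γ _ => ?_
          have hd' : coeff (Finsupp.single 0 d) (u γ) = 0 := h1 γ d (by omega)
          rw [hd', mul_zero, add_zero]
          rcases Nat.lt_or_ge (d + 1) j with hlt | hge
          · rw [h1 γ (d + 1) hlt, mul_zero]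
          · have hdj : d + 1 = j := by omega
            rw [hdj]
            -- degree `j`: `A β γ ≠ 0` forces `γ = r (l+1)`, where `u` has no `s^j`
            by_cases hβ : ∃ l, l < k ∧ β = r' l
            · obtain ⟨l, hl, rfl⟩ := hβ
              by_cases hγ : γ = r (l + 1)
              · subst hγ
                rw [h2 _ (fun m' hm' h => ?_), mul_zero]
                rcases Nat.lt_or_ge m' (l + 1) with h' | h'
                · exact absurd h (ne_of_gt (hmono m' (l + 1) h' (by omega)))
                · exact absurd h (ne_of_lt (hrr'2 (l + 1) m' h' (by omega)))
              · rw [hrowr' l hl γ hγ, zero_mul]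
            · push Not at hβ
              rw [hrow β (fun l hl h => hβ l hl h) γ, zero_mul]
      refine ⟨?_, ?_, ?_⟩
      · -- (i) no degrees `< j + 1`
        intro α d hd
        rw [hu']
        rcases d with _ | d
        · rw [hM, coeff_zero_mulVec_apply]
          exact Finset.sum_eq_zero fun γ _ => by rw [hw0 γ 0 (by omega), mul_zero]
        · rw [hM, coeff_succ_mulVec_apply]
          exact Finset.sum_eq_zero fun γ _ => by
            rw [hw0 γ (d + 1) (by omega), hw0 γ d (by omega), mul_zero, mul_zero, add_zero]
      · -- (ii) degree `j + 1` lives on the rows `r' m'`, `m' ≤ k - (j+1)`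
        intro α hα
        rw [hu', hM, coeff_succ_mulVec_apply]
        refine Finset.sum_eq_zero fun γ _ => ?_
        rw [hw0 γ j le_rfl, mul_zero, add_zero]
        by_cases hαr : ∃ l, l < k ∧ α = r' l
        · obtain ⟨l, hl, rfl⟩ := hαr
          by_cases hγ : γ = r (l + 1)
          · subst hγ
            -- `l > k - (j+1)`: then `coeff_{j+1} (w (r (l+1))) = Σ_β W (r(l+1)) β coeff_j (u β) = 0`
            have hl' : k - (j + 1) < l := by
              by_contra hcon
              exact hα l (by omega) rfl
            rw [hw, hM, coeff_succ_mulVec_apply, Finset.sum_eq_zero, mul_zero]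
            intro β _
            rw [hrow_r (l + 1) (by omega) β, zero_mul, zero_add]
            by_cases hβ : ∃ m', m' ≤ k - j ∧ β = r' m'
            · obtain ⟨m', hm', rfl⟩ := hβ
              rw [hW _ _ (le_of_lt (hmono m' (l + 1) (by omega) (by omega))), zero_mul]
            · push Not at hβ
              rw [h2 β (fun m' hm' h => hβ m' hm' h), mul_zero]
          · rw [hrowr' l hl γ hγ, zero_mul]
        · push Not at hαr
          rw [hrow α (fun l hl h => hαr l hl h) γ, zero_mul]
      · -- (iii) the main coefficient
        have hl0 : k - (j + 1) < k := by omega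
        have hkj : k - (j + 1) + 1 = k - j := by omega
        have hA1' : A (r' (k - (j + 1))) (r (k - j)) = 1 := by rw [← hkj]; exact hA1 _ hl0
        rw [hu', hM, coeff_succ_mulVec_apply, Finset.sum_eq_single (r (k - j))]
        · rw [hw0 _ j le_rfl, mul_zero, add_zero, hA1', one_mul, hw, hM, coeff_succ_mulVec_apply,
            Finset.sum_eq_single (r' (k - j))]
          · rw [hrow_r (k - j) (by omega), zero_mul, zero_add, h3, hkj,
              Finset.prod_eq_prod_Ico_succ_bot (show k - j < k + 1 by omega)]
          · intro β _ hβ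
            rw [hrow_r (k - j) (by omega), zero_mul, zero_add]
            by_cases hβ' : ∃ m', m' ≤ k - j ∧ β = r' m'
            · obtain ⟨m', hm', rfl⟩ := hβ'
              have hm'' : m' < k - j := lt_of_le_of_ne hm' (fun h => hβ (by rw [h]))
              rw [hW _ _ (le_of_lt (hmono m' (k - j) hm'' (by omega))), zero_mul]
            · push Not at hβ'
              rw [h2 β (fun m' hm' h => hβ' m' hm' h), mul_zero]
          · intro h; exact absurd (Finset.mem_univ _) h
        · intro β _ hβ
          rw [hw0 β j le_rfl, mul_zero, add_zero, hrowr' _ hl0 β (by rwa [hkj]), zero_mul]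
        · intro h; exact absurd (Finset.mem_univ _) h
  -- read off the entry `(r 0, r' k)` of `M^{2k+1} = M · M^{2k}`
  obtain ⟨-, h2, h3⟩ := INV k le_rfl
  rw [Nat.sub_self] at h2 h3
  have hentry : (M ^ (2 * k + 1)) (r 0) (r' k) = ((M ^ (2 * k + 1)) *ᵥ e) (r 0) := by
    rw [he, Matrix.mulVec_single_one]; rfl
  rw [hentry, pow_succ', ← Matrix.mulVec_mulVec, hM, coeff_succ_mulVec_apply, Finset.sum_eq_single (r' 0)]
  · rw [hrow_r 0 (by omega), zero_mul, zero_add, h3, Nat.zero_add, Finset.range_eq_Ico,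
      Finset.prod_eq_prod_Ico_succ_bot (show 0 < k + 1 by omega)]
  · intro β _ hβ
    rw [hrow_r 0 (by omega), zero_mul, zero_add, h2 β (fun m' hm' h => hβ ?_), mul_zero]
    rw [h, Nat.le_zero.mp hm']
  · intro h; exact absurd (Finset.mem_univ _) h

end LineMatrix

/-! ## §2 The free triangular pencil `N_{ij} = x_{(ι i, ι j)}` (`i < j`): values, linear parts, and the SEPARATED-PRODUCT test -/

section FreePencil
variable {n b : ℕ}

/-- The free triangular pencil is affine. -/
theorem isAffine_free (ι : Fin b → Fin n) (N : AffMat n b) (hN : ∀ i j, N i j = if i < j then X (ι i, ι j) else 0) :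
    IsAffine N := by
  intro i j
  rw [hN]
  split_ifs
  · exact (totalDegree_X _).le
  · rw [totalDegree_zero]; exact Nat.zero_le _

/-- The free triangular pencil is nilpotent: `N ^ b = 0` (strictly upper triangular over a commutative ring). [folklore] -/
theorem pow_eq_zero_free (ι : Fin b → Fin n) (N : AffMat n b) (hN : ∀ i j, N i j = if i < j then X (ι i, ι j) else 0) :
    N ^ b = 0 := by
  have key : ∀ (L : ℕ) (i j : Fin b), (j : ℕ) < i + L → (N ^ L) i j = 0 := by
    intro L
    induction L with
    | zero =>
      intro i j hij
      rw [pow_zero, Matrix.one_apply, if_neg]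
      intro h; subst h; omega
    | succ L ih =>
      intro i j hij
      rw [pow_succ, Matrix.mul_apply]
      refine Finset.sum_eq_zero fun q _ => ?_
      by_cases hq : (q : ℕ) < i + L
      · rw [ih i q hq, zero_mul]
      · rw [hN q j, if_neg (fun h => by have := Fin.lt_def.mp h; omega), mul_zero]
  refine Matrix.ext fun i j => ?_
  rw [Matrix.zero_apply]
  exact key b i j (by omega)

/-- Point values of the free triangular pencil. -/
theorem pointMat_free (ι : Fin b → Fin n) (N : AffMat n b) (hN : ∀ i j, N i j = if i < j then X (ι i, ι j) else 0)
    (x : Fin n × Fin n → ℂ) (i j : Fin b) : pointMat N x i j = if i < j then x (ι i, ι j) else 0 := by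
  rw [pointMat, Matrix.map_apply, hN]
  split_ifs
  · exact eval_X _
  · exact map_zero _

/-- Linear parts of the free triangular pencil. -/
theorem linMat_free (ι : Fin b → Fin n) (N : AffMat n b) (hN : ∀ i j, N i j = if i < j then X (ι i, ι j) else 0)
    (v : Fin n × Fin n → ℂ) (i j : Fin b) : linMat N v i j = if i < j then v (ι i, ι j) else 0 := by
  classical
  rw [linMat, Matrix.of_apply, linEntry, hN]
  split_ifs
  · simp [MvPolynomial.coeff_X, Finsupp.single_left_inj]
  · simp

/-- ★ **SEPARATED-PRODUCT TEST.**  If `(K, k)` is a whole-pencil ledger of the free triangular pencil and the window sees the power `2k + 1`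
(`2k + 2 ≤ n`), then for all positions `r 0 < r' 0 < r 1 < r' 1 < ⋯ < r k < r' k` and every direction `v ∈ K` the product of the `k + 1`
coordinates `v (ι (r l), ι (r' l))` vanishes — tested at the CONNECTOR point `x = Σ_l δ_{(ι (r' l), ι (r (l+1)))}` on the entry `(r 0, r' k)` of the
`(2k+1)`-st power, where `coeff_pow_apply_of_separated` isolates the product as the `s^{k+1}`-coefficient. -/
theorem prod_eq_zero_of_ledger (ι : Fin b → Fin n) (hι : Function.Injective ι) (N : AffMat n b)
    (hN : ∀ i j, N i j = if i < j then X (ι i, ι j) else 0)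
    {K : Submodule ℂ (Fin n × Fin n → ℂ)} {k : ℕ} (hK : Ledger n b N (fun _ => True) K k) (hk : 2 * k + 2 ≤ n)
    (r r' : ℕ → Fin b) (hrr' : ∀ l, l ≤ k → r l < r' l) (hsep : ∀ l, l < k → r' l < r (l + 1))
    {v : Fin n × Fin n → ℂ} (hv : v ∈ K) :
    ∏ l ∈ Finset.range (k + 1), v (ι (r l), ι (r' l)) = 0 := by
  classical
  set x : Fin n × Fin n → ℂ := fun c => if ∃ l, l < k ∧ c = (ι (r' l), ι (r (l + 1))) then 1 else 0 with hx
  have hdeg := hK x v hv (2 * k + 1) (by omega) (r 0) (r' k) trivial trivial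
  rw [map_lineSubst_eq_pointMat N (isAffine_free ι N hN) x v] at hdeg
  have hcoef := (totalDegree_le_iff_coeff _ k).1 hdeg (k + 1) (Nat.lt_succ_self k)
  rw [coeff_pow_apply_of_separated (pointMat N x) (linMat N v) k r r' hrr' hsep] at hcoef
  · rw [← hcoef]
    refine Finset.prod_congr rfl fun l hl => ?_
    rw [linMat_free ι N hN, if_pos (hrr' l (by simpa [Nat.lt_succ_iff] using Finset.mem_range.mp hl))]
  · intro α β hβα
    rw [linMat_free ι N hN, if_neg (not_lt.mpr hβα)]
  · intro l hl
    rw [pointMat_free ι N hN, if_pos (hsep l hl), hx]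
    dsimp only
    rw [if_pos ⟨l, hl, rfl⟩]
  · intro α β hαβ
    rw [pointMat_free ι N hN]
    split_ifs with hlt
    · rw [hx]
      dsimp only
      rw [if_neg]
      rintro ⟨l, hl, hc⟩
      obtain ⟨h1, h2⟩ := Prod.mk.inj hc
      exact hαβ l hl (hι h1) (hι h2)
    · rfl

/-- ★ **A DEAD COORDINATE IN EVERY SEPARATED TUPLE.**  Under the hypotheses of `prod_eq_zero_of_ledger`, one of the `k + 1` coordinates
`(ι (r l), ι (r' l))` vanishes identically on `K` (a subspace over an infinite field is not a finite union of proper subspaces —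
Mathlib `Module.Dual.exists_forall_mem_ne_zero_of_forall_exists`). -/
theorem exists_dead_of_ledger (ι : Fin b → Fin n) (hι : Function.Injective ι) (N : AffMat n b)
    (hN : ∀ i j, N i j = if i < j then X (ι i, ι j) else 0)
    {K : Submodule ℂ (Fin n × Fin n → ℂ)} {k : ℕ} (hK : Ledger n b N (fun _ => True) K k) (hk : 2 * k + 2 ≤ n)
    (r r' : ℕ → Fin b) (hrr' : ∀ l, l ≤ k → r l < r' l) (hsep : ∀ l, l < k → r' l < r (l + 1)) :
    ∃ l, l ≤ k ∧ ∀ v ∈ K, v (ι (r l), ι (r' l)) = 0 := by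
  by_contra hcon
  push Not at hcon
  obtain ⟨v, hv, hne⟩ := Module.Dual.exists_forall_mem_ne_zero_of_forall_exists K
    (fun l : Fin (k + 1) => (LinearMap.proj (ι (r l), ι (r' l)) : Module.Dual ℂ (Fin n × Fin n → ℂ)))
    (fun l => by
      obtain ⟨v, hv, hne⟩ := hcon l (Nat.lt_succ_iff.mp l.2)
      exact ⟨v, hv, by rwa [LinearMap.proj_apply]⟩)
  have h0 := prod_eq_zero_of_ledger ι hι N hN hK hk r r' hrr' hsep hv
  rw [Finset.prod_eq_zero_iff] at h0
  obtain ⟨l, hl, h0⟩ := h0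
  exact hne ⟨l, Finset.mem_range.mp hl⟩ (by rwa [LinearMap.proj_apply])

end FreePencil

end Summit.ValiantsHypothesis.ValiantsHypothesis.Theorems.GrenetZeon.FreeTriangularPrice

end
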